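import Mathlib
import HarnessLib
import HarnessLib.Audit
import Summits.Langlands.Statement
import Literature.Barriers.Langlands.NonRegularWeightBarrier
import Literature.NumberTheory.Automorphic.GLnAdelicStructureProofs
import HarnessLib.Audit.Status.Attr

/-!
Route: MaassFreeConverse

# Route MaassFreeConverse — Maass-free converse theorem — (B) for regular ρ over ℚ iff its twisted
critical Rankin–Selberg values pass every algebraic period-relation test of level N

It suffices to show X = K_B ∧ K_D for the TARGET RegularInsolubleDescent = direction (B) over ℚ in
the regular sector, in junk-free potential-automorphy form: an irreducible ρ : G_ℚ → GL_n(ℚ̄_ℓ) (n =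
m+1 ≥ 2) which over SOME number field F is Satake–Frobenius compatible a.e. (HLTT normalisation, as
lang.S27) with a cuspidal cohomological Π of GL_n(𝔸_F) of ADMISSIBLE weight wt (some pure weight wt'
of GL_m leaves ≥ 3 consecutive critical shifts, e.g. GL_2 weight k ≥ 4) is Satake–Frobenius
compatible a.e. with a cuspidal cohomological π of GL_n(𝔸_ℚ) of weight wt — automorphy DESCENDS
along the (possibly insoluble) extension that potential automorphy leaves behind. Card
cohomological-converse-critical-cocycle ("critical values form a cocycle"), recast as an ALGEBRAIC
PERIOD-RELATION CRITERION: K_D (AlgebraicRelationsDecide) — for admissible (n, N, wt) there is a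
valid criterion datum: a point s₀, per-τ constants D(τ, parity), ramified-τ local data δ and a set R
of FINITELY SUPPORTED RELATIONS WITH ALGEBRAIC COEFFICIENTS among the probes (τ cuspidal regular
algebraic = cohomological on GL_m, q, χ mod q) such that a card-n Satake family α (with bad-factor
data γ) is a.e. that of a cuspidal cohomological π of weight wt and level K(N) iff its normalised
twisted Rankin–Selberg values D·L_f(s₀, α ⊗ χ × τ) kill R (NECESSITY ∧ CONVERSE); only COHOMOLOGICAL
twists enter — no Maass forms; K_B (CriticalValuesBettiRational) — for ρ as above, the Frobenius
family of ρ passes every valid criterion ("the critical values of ρ are Betti-rational relative to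
GL_n-periods": where (B) lives); not part of X (support since the g3 retriage of 2026-08-15, idle in
closes): K_PA (SolubleJointPotentialAutomorphy, Taylor's soluble shape) — the foreseen layer-2 input
of K_B that makes ρ's left-of-centre values and the Brauer factorisation of its periods available.
Lean: `CriticalValuesBettiRational ∧ AlgebraicRelationsDecide`

## Assembly
Rev 5 (badge repair 2026-08-16): `theorem closes (hB : CriticalValuesBettiRational) (hD :
AlgebraicRelationsDecide) (hG : CriterionDescent) (hJ : RegularSectorJunction) : _root_.Langlands :=
hJ (hG hB hD)`. The elementary logic now lives in the support GLUE ITEM CriterionDescent :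
CriticalValuesBettiRational → AlgebraicRelationsDecide → RegularInsolubleDescent (the target is
reachable from the two cruxes by an item; provable now — it is the rev-0…4 inline body of closes, rc
0 sorry-free in the planner's Sketch.lean, attached to the item as candidate proof): given ρ in the
sector, CriticalValuesBettiRational yields (N, S, α) and the ∀-datum clause;
AlgebraicRelationsDecide (with hc := isCompact_glFiniteIntegralLevel_holds) yields a valid datum
(algebraic ∧ NECESSITY ∧ CONVERSE); the clause (fed NECESSITY) yields γ with Kills; CONVERSE yields
a cuspidal π of weight wt with HasSatakeParamAt v (α v) a.e.; intersecting with the cofinite set off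
S gives the target's a.e. Satake–Frobenius compatibility; RegularSectorJunction ends in
_root_.Langlands. SolubleJointPotentialAutomorphy (support since the g3 retriage) is no longer a
hypothesis of closes — it was idle there (three retriage notes) and as an open-problem hypothesis it
would have kept the deciding theorem conditional on an item the glue never uses; it stays filed at
rank 4 as the foreseen layer-2 input of CriticalValuesBettiRational (Brauer factorisation /
left-half values) and re-hangs there at the first split. The Assembly item keeps its rev-0 shape
CriticalValuesBettiRational → AlgebraicRelationsDecide → SolubleJointPotentialAutomorphy →
RegularSectorJunction → Langlands (implied by closes with the third hypothesis idle; not restated to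
avoid item churn).

Rationale: WHY THIS LINE. A converse theorem that lives in Betti cohomology: by Kazhdan–Mazur–Schmidt /
Kasten–Schmidt (KazhdanMazurSchmidt2000, KastenSchmidt2012, Januszewski2011) and
Raghuram–Shahidi–Sun (Raghuram2009, RaghuramShahidi2010, Sun2016) the GL_m-relative periods of a
cohomological cusp form on GL_n are the critical values L(κ, π ⊗ χ × τ) against COHOMOLOGICAL τ
only, and the relation module of these symbols is defined over ℚ̄ (rational classes, rational
cycles) — so every linear relation among normalised critical values that automorphy forces has
ALGEBRAIC coefficients; conversely (this session's analysis, NOTES.md) algebraic relations + a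
linear-independence lemma for twisted Euler products in the twist aspect (LuoRamakrishnan1997-type,
provable) characterise automorphic Satake families with NO analytic continuation and NO Maass twists
— the reason analytic converse theorems (Cogdell–PS doi:10.1515/crll.1999.507.165,
BookerKrishnamurthy2014IMRN) stop at rank 3 is gone for algebraic targets. For ρ potentially
automorphic the same numbers exist unconditionally (absolutely convergent Euler products right of
the boundary; Taylor2006 §6 / BarnetlambEtAl2014 + Brauer for the mirror side), so (B) for regular ρ
over ℚ becomes: "ρ's critical values satisfy the algebraic relations of level N" — for n = 2
Eichler–Shimura–Manin read backwards (Razar1977, Shimura1977, Merel1994), for n = 3, 4 testable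
against Ash–Grayson–Green / Ash–Gunnells–McConnell-type computations with non-trivial coefficients
(AshGunnellsMcconnell2002, doi:10.1016/0022-314x(84)90081-7, doi:10.1080/10586458.1997.10504604).
Imported areas: automorphic period integrals and Deligne-type algebraicity (arithmetic of special
values), topology of arithmetic groups (source of the relations, layer 2), potential automorphy.
What prior routes / the retired gen-1 route do not do: gen-1 (route-Langlands-CriticalCocycle) typed
"∃ finite presentation" and was refuted as typed (finite probes: zero-padding / perturbation); here
probes are ALL χ-twists (perturbation-proof), candidates carry card-n families with explicit bad
factors, values are honest absolutely convergent limits with |y| < q^(Re s₀), and the relation set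
is constrained by ALGEBRAICITY instead of an unavailable symbol map — the typed criterion is true
modulo published theorems yet still decides (B); negatives index (1 entry, K3 Kuga–Satake)
untouched.

RANKED CRUXES. #0 RegularInsolubleDescent (target) — (B) over ℚ, regular admissible sector,
potential-automorphy form: m ≥ 1, ρ : G_ℚ → GL_(m+1)(ℚ̄_ℓ) irreducible, wt with a pure wt' on GL_m
leaving three consecutive interlacing shifts, F any number field, P cuspidal of GL_(m+1)(𝔸_F) of
infinity type cohomologicalInfinityType (dual wt), Satake–Frobenius compatible a.e. with ρ|_F
(arithFrobPolyOfSatake ι q (m+1) α) ⇒ a cuspidal π over ℚ of the same infinity type,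
Satake–Frobenius compatible a.e. with ρ. (why it might fail: False only if an irreducible regular ρ
is cuspidal-cohomological over an insoluble F yet not over ℚ; FM+Langlands say never, but every tool
stops at soluble Gal(F/ℚ) (Arthur–Clozel) and F here is arbitrary.) [BarnetlambEtAl2014,
PatrikisTaylor2014, Taylor2006, ArthurClozelAMS120, HarrisLanTaylorThorneRMS2016,
Literature.Barriers.Langlands.SolvableImageBarrier]
#2 CriticalValuesBettiRational (crux) — (card: "the cocycle identity", where (B) lives) for ρ in the
target sector there are a level N ≥ 1, a finite S and a card-(m+1) family α with ρ unramified and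
HasFrobCharpolyAt (arithFrobPolyOfSatake ι q (m+1) (α v)) off S such that for EVERY criterion datum
(s₀, D_even, D_odd, δ, R) at (m, N, wt) satisfying the NECESSITY clause of AlgebraicRelationsDecide
(all genuine cuspidal π of weight wt and level K(N) kill R) there are bad-factor data γ with which
the normalised twisted Rankin–Selberg values of α kill R too (the value of a probe (S', τ, q, χ) is
D(τ, parity χ) times the absolutely convergent Euler product over ALL places of the local multisets
γ_v⊗β_v (v | N), α_v⊗δ_v (v ∈ S'), α_v⊗β_v (else) twisted by χ at s₀). Implied by automorphy of ρ
(trivially) and implying it given AlgebraicRelationsDecide — stated openly: this is (B) in the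
sector, in the form "ρ passes every level-N period-relation test that automorphic forms pass"; its
own handles = Deligne/Raghuram-type algebraicity for the twisted critical values of ρ × τ (periods
factorising along the Brauer sum of crux 4) plus coincidence of the Galois-equivariant algebraic
parts with those of level N; first open instances: regular non-self-dual GL_3 eigensystems with
Hodge–Tate gaps ≥ 3 and regular CM-inductions through non-normal fields (NonNormalInduction). [deps:
AlgebraicRelationsDecide] [difficulty: open-problem] (why it might fail: It IS (B) in disguise:
false iff some regular pot. automorphic ρ/ℚ is not automorphic. As a handle: needs Deligne's
conjecture for ρ⊗χ×τ with periods FACTORISING along Brauer's virtual sum (Harris–Lin period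
relations, arXiv:1608.07527) — open beyond CM/polarized cases.) [Raghuram2009, RaghuramShahidi2010,
KastenSchmidt2012, arXiv:1608.07527, arXiv:1802.02958, arXiv:1511.03517,
doi:10.1080/10586458.1997.10504604, LuoRamakrishnan1997]
#3 AlgebraicRelationsDecide (crux) — (card S1+S2 in decidable form: the Maass-free converse theorem)
for m ≥ 1, N ≥ 1, admissible wt and the compactness facts hc there is a VALID datum: s₀ ∈ ℂ; D_even,
D_odd : (S', τ) → ℂ; δ : (S', τ) → places → multisets; R a set of finitely supported ℂ-relations on
probes ((S', τ cuspidal regular algebraic on GL_m), q, χ mod q) with ALGEBRAIC coefficients, such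
that NECESSITY (every cuspidal π of GL_(m+1)/ℚ of infinity type cohomologicalInfinityType (dual wt)
with a K(N)-fixed vector and Satake family α off N kills R for some γ) and CONVERSE (any card-(m+1)
α with some γ killing R is a.e. the Satake family of such a π) hold; a probe value is D(τ, parity χ)
× the absolutely convergent (|y| < q^(Re s₀), summable, non-zero) Euler product over all places of
the local multisets (γ⊗β at v | N, α⊗δ at v ∈ S', α⊗β elsewhere) twisted by χ at s₀; Maass τ never
enter (τ regular algebraic in the probe type). Intended witness: s₀ = interior right-half critical
point, D = c_∞/p(τ), δ = L-parameters of ramified τ_v, R = all algebraic relations of genuine value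
vectors; proof route: Raghuram/Shimura/Kasten–Schmidt algebraicity ⇒ span of genuine vectors is
ℚ̄-rational per parity; CONVERSE by TwistedEulerIndependence + Chebotarev via lang.S27. [deps:
TwistedEulerIndependence] [difficulty: L] (why it might fail: Bookkeeping is the risk: needs
L_f(s₀,(π⊗χ)×τ)/(p^±(π)p^±(τ)c_∞) ∈ ℚ̄ for ALL χ with a parity-only archimedean constant
(Raghuram2009 Thm 1.1 + RaghuramShahidi2010 twisting) and bad factors = L-parameter products (JPSS
essential/test vectors); fails if c_∞ depends on more than parity.) [Raghuram2009,
RaghuramShahidi2010, arXiv:1312.5955, arXiv:2109.05273, KastenSchmidt2012, Sun2016, Shimura1977,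
doi:10.1007/bf01450798, arXiv:1201.5506, arXiv:1903.03458, JacquetShalikaAJM1981,
LuoRamakrishnan1997]
#4 SolubleJointPotentialAutomorphy (support; crux until the g3 retriage of 2026-08-15 — idle in
closes, implied by the target via F' := ℚ; rank 4 kept for the layer-2 re-hang under
CriticalValuesBettiRational) — (card S3, in Taylor's "soluble shape") for ρ in the target sector and
every cuspidal regular algebraic τ on GL_m/ℚ there is a finite Galois F'/ℚ, totally real or CM, such
that over EVERY E ⊆ F' with Gal(F'/E) soluble, ρ|_E is Satake–Frobenius compatible a.e. with a
cuspidal regular algebraic rep of GL_(m+1)(𝔸_E) and τ has an automorphic weak base change to E. By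
Brauer over Gal(F'/ℚ) and Jacquet–PS–Shalika this makes Λ(s, ρ ⊗ χ × τ) meromorphic with functional
equation and every off-centre critical value an unconditional number (layer 2 of
CriticalValuesBettiRational: explicit Manin-type relations mixing both halves; Brauer factorisation
of periods). [difficulty: open-problem] (why it might fail: ρ is ONE ℓ-adic rep automorphic over an
arbitrary F (black box): a common F' with soluble descent needs ρ, ρ_τ odd, polarizable, in
compatible systems, residually adequate (BLGGT 5.4.1 + Arthur–Clozel); non-self-dual τ on GL_3, GL_4
and non-CM F escape all tools.) [BarnetlambEtAl2014, Taylor2006, ArthurClozelAMS120,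
PatrikisTaylor2014, Qian2022, ACCGHLNSTT2023, HarrisLanTaylorThorneRMS2016]
#9 RegularSectorJunction (support) — the rest of the summit: (B) in the regular admissible sector
over ℚ (a.e. form) ⇒ Langlands (upgrade a.e. to Corresponds by LGC + strong multiplicity one;
geometric ⇒ potentially automorphic; weights with < 3 critical shifts incl. weight-2 type and Artin
type; other n, F; direction (A)). Not this route's business; filed so that closes ends in the summit
constant (same convention as the other sector routes of this summit). [difficulty: open-problem]
[BuzzardGeeLMS2014, FontaineMazurGeometric1995, BarnetlambEtAl2014]
#9 TwistedEulerIndependence (support) — (the linear-independence lemma CONVERSE rests on; provable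
now) finitely many families of local multisets M_i : places → nonzero complex numbers of bounded
size with ‖x‖ ≤ C q^θ, ‖x‖ < q^(Re s₀), Re s₀ > 1 + θ, PAIRWISE DIFFERENT AT INFINITELY MANY PLACES:
the functions (q, χ) ↦ lim_X ∏_(q_v ≤ X) ∏_(x ∈ M_i v) (1 − x χ(v) q_v^(−s₀))^(−1) on Dirichlet
characters of a fixed parity and conductor-modulus prime to a finite B are linearly independent over
ℂ. (Infinite distinctness is necessary: 1/((1−yX)(1−zX)) = 2/((1−xX)(1−zX)) − 1/((1−xX)(1−yX)) for
x, y, z in arithmetic progression — distinct Euler products differing at one place can be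
dependent.) Proof: orthogonality over χ mod large primes extracts Dirichlet coefficients; then
induction on the number of families using a separating place. [difficulty: provable-now]
[LuoRamakrishnan1997, doi:10.1515/forum.2006.001, JacquetShalikaAJM1981]
#9 CriterionDescent (support) — GLUE (rev-5 badge repair): CriticalValuesBettiRational →
AlgebraicRelationsDecide → RegularInsolubleDescent — the two cruxes imply the target, so the target
is reachable from the cruxes by an ITEM and closes := hJ (hG hB hD) has exactly the hypotheses K_B,
K_D, this glue and RegularSectorJunction; elementary logic, provable now (the former inline body of
closes: K_B gives (N, S, α) + the ∀-datum clause, K_D with hc :=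
isCompact_glFiniteIntegralLevel_holds gives a valid datum, NECESSITY feeds the clause, CONVERSE
gives π, cofinite intersection off S; rc 0 sorry-free in Sketch.lean, attached as candidate proof).
[deps: CriticalValuesBettiRational, AlgebraicRelationsDecide] [difficulty: provable-now]
DEFERRED at rev 1 (cone repair 2026-08-15; NOT items any more, re-filed by `workitem add` when layer
2 is split): InteriorCohomologyFiniteDim — H^(b_n)_!(S(K_f(N)), V_λ ⊗ ℂ) = CuspidalCohomologyGL n N
wt finite-dimensional for N ≥ 1 (Borel–Serre / Raghunathan; the hypothesis of
RelativeModularSymbolPresentation.kills_iff_exists_eq, layer 2 only) [BorelSerre1973, Schwermer2010,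
GetzHahn2024]; NonNormalInduction — automorphic induction of an algebraic Hecke character through a
possibly non-normal K/ℚ (the natural first open instances of the target: regular CM-inductions of
degree 10 with A_5-quintic subfield) [ArthurClozelAMS120, JPSS1981Cubique,
Literature.NumberTheory.Automorphic.automorphicInduction_character]. Reason: neither is a hypothesis
of `closes`, and their vocabulary (CuspidalCohomologyGL.lean, HeckeCharacter.lean) drags 66
Literature modules with 34 unproved named facts (strong multiplicity one, Flath, Jacquet–Langlands,
quaternionic, base-change/CM/Sym^n sweep facts, Artin conductor, Hecke L-function FE, cuspidal
eigenclass existence …) into the route file's import cone, none of which the typed items or the glue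
use; the typed route now imports only Literature.Barriers.Langlands.NonRegularWeightBarrier
(cohomologicalInfinityType) and GLnAdelicStructureProofs (isCompact_glFiniteIntegralLevel_holds for
the glue) on top of the Statement, and the admissibility clause spells out
RelativeModularSymbol.Interlaces wt (Weight.dual (wt' + k)), k = j−1, j, j+1, verbatim as ∀ i, −(wt'
i.rev + k) ≤ wt i.castSucc ∧ wt i.succ ≤ −(wt' i.rev + k) (Iff.rfl with rev 0) instead of importing
RelativeModularSymbolPresentation.

TWO-LAYER PLAN. CriticalValuesBettiRational ⇐ PeriodFactorisation (Deligne periods of the Brauer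
virtual sum ∏ Λ(Π_(E_j) × T_(E_j))^(n_j) factor as p^±(ρ)·p^±(τ)·(algebraic): Harris–Lin /
Grobner–Harris–Lin period relations along SolubleJointPotentialAutomorphy) → AlgebraicCoincidence
(the Galois-equivariant vector of algebraic parts of ρ lies in the ℚ̄-span of the level-N vectors) →
CriticalValuesBettiRational. AlgebraicRelationsDecide ⇐ RationalSpan (Raghuram/Shimura algebraicity
for all χ, both parities, with bad factors = L-parameter products) →
TwistedEulerIndependence-application (+ Chebotarev via lang.S27) → AlgebraicRelationsDecide.
EXPLICIT MODE (card S1/S2, informal items filed after open): the relation set R of the genuine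
Kazhdan–Mazur–Schmidt presentation is generated by Manin-type topological relations (n = 2:
Manin/ManinK; n = 3, 4: Voronoi/sharbly, AshGunnellsMcconnell2002) — needs the definition requests
below.

KILL CRITERIA. (i) AlgebraicRelationsDecide refuted AS TYPED by a normalisation counterexample (e.g.
an archimedean constant depending on more than the parity of χ, or a bad factor that is not an
L-parameter product) ⇒ restate with the corrected recipe (misstated, not fatal); refuted IN
SUBSTANCE (for some admissible (n,N,wt) the ℚ̄-closure of the genuine value vectors contains a
non-automorphic Eulerian vector — a transcendence failure of Raghuram-type algebraicity) ⇒ the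
converse principle is dead: close refuted:AlgebraicRelationsDecide. (ii) A numerically certified
failure of a level-N algebraic relation for a GENUINE ρ_π (n = 2, k = 4, N ≤ 11) ⇒
mis-normalisation, restate. (iii) CriticalValuesBettiRational refuted ⇒ (B) fails (summit-level
event). (iv) SolubleJointPotentialAutomorphy refuted for a non-self-dual τ ⇒ restrict layer 2 to
polarizable τ; not fatal. (v) RegularInsolubleDescent proved elsewhere (e.g. by a patching route)
moots the route.

NOT DECOMPOSED YET. The explicit relation module (Kazhdan–Mazur–Schmidt symbol map needs compactly
supported cohomology of the arithmetic quotient and the relative-cycle pull-back — definition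
request); the n = 2 calibration over ManinK/PolySymbol (informal support after open); archimedean
constants and sign bookkeeping (inside crux 3); Eisenstein τ (not needed: CONVERSE uses cuspidal τ
only); weights with fewer than three critical shifts (weight-2 / weight-3 type: boundary or central
values only — a different idea); LGC upgrade to Corresponds and other base fields (junction). Cone
note (rev 1): when the informal explicit-mode items (stmt-Langlands-13658/13659/13660) get
signatures over RelativeModularSymbolPresentation / CuspidalCohomologyGL, those imports return —
discharge GLnCohomology.cuspidalEigenclass_exists and GLnCohomology.interiorEigenclass_isCuspidal
first or state them over the Statement-cone vocabulary; no Literature fact is needs-fact for the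
typed route.

CHEAPEST FALSIFIER. n = 2, N = 1, wt = (10, 0) (weight 12, Δ): take s₀ = 8 (interior right-half
critical point of L(Δ ⊗ χ, s)), probes = even χ mod primes q ≤ 50; compute v(χ) = L(8, Δ ⊗
χ)·τ(χ̄)/((2πi)^8 ω⁺) with Dokchitser/PARI and LLL-search algebraic (cyclotomic) linear relations
among them; then replace Δ's a_p by a fake multiplicative sequence with the same size (e.g. a_2 ↦
−a_2) and check that the fake vector violates a found relation. If genuine values show NO cyclotomic
relations beyond Galois-conjugation, or fakes satisfy all of them, the decidable form of the
converse principle is empty at level 1 (one afternoon, PARI; not run here — hub is compute-free and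
searchd was down this session).

NUMBERS. Admissibility = three consecutive critical shifts: GL_2 weight k ≥ 4 (Hodge–Tate gap ≥ 3);
GL_3 × GL_2: wt = (a,b,c) pure, needs a − b ≥ 2 and b − c ≥ 2. Bottom degrees b_2 = 1, b_3 = 2, b_4
= 4 (GLnCohomology.bottomDegree). First open non-self-dual instances: the 3-dimensional Galois
representations of van Geemen–Top in H²(S_a) matched numerically with cuspidal classes of Γ_0(128) ⊂
SL_3(ℤ) (doi:10.1080/10586458.1997.10504604); regular CM-inductions of degree 10
(NonNormalInduction). Items at open: 9 (3 cruxes); after the rev-1 cone repair: 7 typed (target, 3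
cruxes, 2 support, assembly) + 3 informal; after the g3 retriage (2026-08-15) 2 cruxes
(SolubleJointPotentialAutomorphy → support); after the rev-5 badge repair (2026-08-16): 8 typed
(target, 2 cruxes, 4 support = SolubleJointPotentialAutomorphy, RegularSectorJunction,
TwistedEulerIndependence, CriterionDescent, assembly) + 3 informal = 11 ≤ 15; closes has four
hypotheses (K_B, K_D, CriterionDescent, RegularSectorJunction).

DEFINITION REQUESTS. (D1) `twistedRankinSelbergEulerValue α β χ s`
(Literature/NumberTheory/LFunctions): the absolutely convergent partial Euler product of two Satake
families twisted by a Dirichlet character and its continued value — would shrink cruxes 2–3 by 60 %.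
(D2) `KMSRelativeSymbol` (Literature/NumberTheory/Automorphic): the Kazhdan–Mazur–Schmidt symbol MAP
for RelativeModularSymbolPresentation, via compactly supported cohomology of TwistedQuotient
(mapping cone of the existing boundary coaugmentation) and pull-back along the proper maps F_g —
makes the explicit-relation cruxes typable. (D3) `satakeFamilyOfFramedGaloisRep ι ρ`
(GaloisRepresentations): the a.e. Satake family read off HasFrobCharpolyAt. Filed after open with
`ledger workitem add --kind definition`.

Novelty: Searches (2026-08-15; `lit search` local/ --hybrid: searchd rc 75 all session; OpenAlex/S2 HTTP 429;
zbMATH and galaxy worked):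
`lit galaxy search "relative modular symbols" --star all` (1: Kasten's thesis
pdf:8497789907659818320 = twisted RS convolutions, the value
formula); `"twists of critical L-values" --star all` (4: Anamby–Pal arXiv:2401.12891,
Imamoglu–Lägeler–Tóth, Wei–Yi — determination
among GENUINE forms only); `"critical values of Rankin-Selberg"`, `"converse theorem critical
values"`, `"linear independence of
L-functions"` --star all (1/0/0); zbMATH: "Linear independence of L-functions" (6:
Kaczorowski–Molteni–Perelli doi:10.1515/forum.2006.001 —
independence in the s-aspect inside the Selberg class, not the twist aspect; Cimpoeaş–Nicolae
Artin), "determination of modular forms by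
twists of critical L-values" (3: LuoRamakrishnan1997 doi:10.1007/s002220050189, Li 2007, Munshi 2010
— injectivity among genuine forms =
our NECESSITY-side half), "special values of certain Rankin-Selberg L-functions" (6: Harris–Lin
arXiv:1608.07527, KazhdanMazurSchmidt2000,
Grobner–Harris arXiv:1308.5090, Harder–Raghuram arXiv:1405.6513), "Raghuram Shahidi period
relations" (RaghuramShahidi2010
doi:10.1093/imrn/rnn077, Raghuram arXiv:1312.5955, Li–Liu–Sun arXiv:2109.05273), "converse theorem
Eichler cohomology" (Weissauer
doi:10.1007/bf02950755, Imamoglu–Martin doi:10.4064/aa123-4-5 — GL_2 period-side converse theorems),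
"test vectors Rankin-Selberg"
(Booker–Krishnamurthy–Lee arXiv:1903  [refs: 10.1515/forum.2006.001, 10.1007/s002220050189, 10.1093/imrn/rnn077, 10.1007/bf02950755, 10.4064/aa123-4-5, 10.1007/bf01450798, 10.2140/pjm.2012.260.515, 2401.12891, 1608.07527, 1308.5090, 1405.6513, 1312.5955, 2109.05273, 1903.03458, doi:10.1515/forum.2006.001, doi:10.1007/s002220050189, doi:10.1093/imrn/rnn077, doi:10.1007/bf02950755, doi:10.4064/aa123-4-5, doi:10.1007/bf01450798, doi:10.2140/pjm]

Barriers (technique_class: converse-theorem critical-values betti-periods): - technique_class: converse-theorem critical-values betti-periods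
- Literature.Barriers.Langlands.SolvableImageBarrier: clause (b) (Brauer/potential automorphy give
meromorphy and FE, never automorphy) is accepted verbatim — the target IS the residual insoluble
descent; the extra input is arithmetic (algebraic relations among critical values), not base change
along insoluble layers; SolubleJointPotentialAutomorphy descends only along soluble F'/E, exactly
where Arthur–Clozel applies.
- Literature.Barriers.Langlands.SolvableImageBarrierNarrow: same; NonNormalInduction sits inside the
barrier's residual class on purpose (regular, not Artin, characters).
- Literature.Barriers.Langlands.NonRegularWeightBarrier: NOT evaded and not meant to be — admissible
weights have three consecutive critical shifts (regular, Hodge–Tate gaps ≥ 3 for GL_2);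
cohomologicalInfinityType is the technique class of the barrier used as vocabulary; weight-one/Artin
and weight-2 types go to the junction.
- Literature.Barriers.Langlands.ShimuraVarietyRealizationBarrier: irrelevant on the converse side
(GL_n/ℚ locally symmetric spaces always have Betti cohomology); enters only through Galois
representations of the cohomological twists τ (lang.S27) inside the proof of crux 3 and through crux
4.
- Literature.Barriers.Langlands.TaylorWilesNumericalCoincidence: not engaged — no deformation
theory, no patching; residual hypotheses appear only inside the imported potential-automorphy
theorems of crux 4.
- Literatu

History (route lifecycle, newest last):
- 2026-08-15T20:03:59Z · rev 1: restated RegularInsolubleDescent (stmt-Langlands-13623), CriticalValuesBettiRational (stmt-Langlands-13624), AlgebraicRelationsDecide (stmt-Langlands-13625), SolubleJointPotentialAutomorphy (stmt-Langlands-13626) — route-repair (cone, rrepair-Langlands-MaassFreeConverse-597186cf): imports RelativeModularSymbolPr (planner-rrepair-Langlands-MaassFreeConverse-597186cf-0)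
- 2026-08-15T20:03:59Z · rev 1: dropped InteriorCohomologyFiniteDim, NonNormalInduction — route-repair (cone, rrepair-Langlands-MaassFreeConverse-597186cf): imports RelativeModularSymbolPresentation + HeckeCharacter → Literature.Barriers.Langlands.No (planner-rrepair-Langlands-MaassFreeConverse-597186cf-0)
- 2026-08-15T20:08:13Z · rev 1: dropped InteriorCohomologyFiniteDim, NonNormalInduction — route-repair (cone) — RE-ADD after gate partial-apply at 20:03:59Z (restate recorded old entries as replaced_by stmt-Langlands-13790..13793, which were rolled b (planner-rrepair-Langlands-MaassFreeConverse-597186cf-0)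
- 2026-08-22T14:16:36Z · DORMANT — reconciler: no traction for 5.4 d (last activity item-evidence-added at 2026-08-17T04:13:20Z); parked, not closed — `ledger route dormant route-Langlands-MaassF (operator:999:3595047)
- 2026-08-31T16:01:00Z · REACTIVATED (open) — reconciler: reactivated — activity item-proof-filed at 2026-08-31T15:22:45Z after parking at 2026-08-22T14:16:36Z (operator:999:743146)

sub-problem: Langlands · status: open · opened planner-plancard-Langlands-Langlands-cohomolo-5eafa618-g2-0 2026-08-15T19:28:59Z · rev 6 · ledger route-Langlands-MaassFreeConverse
GENERATED by the gate from the ledger (D-0016/17). Provers cite these decls: `theorem foo : Summit.Langlands.Langlands.Theses.MaassFreeConverse.<Decl> := …` in Summits/Langlands/Langlands/Theorems/<Name>.lean.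
-/

namespace Summit.Langlands.Langlands.Theses.MaassFreeConverse

open scoped BigOperators Topology Manifold Classical MeasureTheory ProbabilityTheory Matrix InnerProductSpace ComplexConjugate ContinuousMap
open Filter Set Function TopologicalSpace MeasureTheory

attribute [summit_statement] _root_.Langlands

-- earlier RegularInsolubleDescent (stmt-Langlands-13623, replaced 2026-08-15T20:03:59Z -> stmt-Langlands-13790): retired by None — open Literature.NumberTheory.Automorphic Literature.NumberTheory.GaloisRepresentations Literature.NumberTheory.DiophantineGeometry Literature.Barriers.Langlands IsDedekindDomain NumberField in ∀ (m : ℕ), 1 ≤ m → ∀ (ℓ : ℕ) [Fact ℓ.Prime] (ι : PadicAlgCl ℓ ≃+* ℂ) (ρ : Fram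
/-- item stmt-Langlands-13892 · target · rank 0 · open · by planner
why it might fail: False only if some irreducible ρ/ℚ, cuspidal-cohomological over SOME number field F (arbitrary, insoluble closure allowed), is not cuspidal of weight wt over ℚ. FM + functoriality say never; descent in print only along soluble layers (Arthur–Clozel, BLGHT 1.4) or for polarizable resid. adequate ρ.
sources: BarnetlambEtAl2014, BarnetlambEtAl2011, ArthurClozelAMS120, PatrikisTaylor2014, Taylor2006, Calegari2023
[target] (B) over ℚ, regular admissible sector, potential-automorphy form: m ≥ 1, ρ : G_ℚ →
GL_(m+1)(ℚ̄_ℓ) irreducible, wt with a pure wt' on GL_m leaving three consecutive interlacing shifts,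
F any number field, P cuspidal of GL_(m+1)(𝔸_F) of infinity type cohomologicalInfinityType (dual
wt), Satake–Frobenius compatible a.e. with ρ|_F (arithFrobPolyOfSatake ι q (m+1) α) ⇒ a cuspidal π
over ℚ of the same infinity type, Satake–Frobenius compatible a.e. with ρ. [rev 1: the admissibility
clause writes RelativeModularSymbol.Interlaces wt (Weight.dual (wt' + k)), k = j−1, j, j+1, out
verbatim as ∀ i, −(wt' i.rev + k) ≤ wt i.castSucc ∧ wt i.succ ≤ −(wt' i.rev + k) — definitionally
the rev-0 statement (Iff.rfl, Equiv.lean in the repair folder); no import of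
RelativeModularSymbolPresentation.] -/
@[route_item "route-Langlands-MaassFreeConverse"]
def RegularInsolubleDescent : Prop :=
  open Literature.NumberTheory.Automorphic Literature.NumberTheory.GaloisRepresentations Literature.NumberTheory.DiophantineGeometry Literature.Barriers.Langlands IsDedekindDomain NumberField in ∀ (m : ℕ), 1 ≤ m → ∀ (ℓ : ℕ) [Fact ℓ.Prime] (ι : PadicAlgCl ℓ ≃+* ℂ) (ρ : FramedGaloisRep ℚ (PadicAlgCl ℓ) (m + 1)) (wt : Fin (m + 1) → ℤ) (F : Type) [Field F] [NumberField F] (hF : isCompact_glFiniteIntegralLevel (m + 1) F) (P : CuspidalAutomorphicRepData (m + 1) F hF), ρ.toGaloisRep.IsIrreducible → (∃ (wt' : Fin m → ℤ) (w' j : ℤ), (∀ i, wt' i + wt' (Fin.rev i) = w') ∧ (∀ i : Fin m, -(wt' i.rev + (j - 1)) ≤ wt i.castSucc ∧ wt i.succ ≤ -(wt' i.rev + (j - 1))) ∧ (∀ i : Fin m, -(wt' i.rev + j) ≤ wt i.castSucc ∧ wt i.succ ≤ -(wt' i.rev + j)) ∧ (∀ i : Fin m, -(wt' i.rev + (j +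 1)) ≤ wt i.castSucc ∧ wt i.succ ≤ -(wt' i.rev + (j + 1)))) → P.1.HasInfinityType (cohomologicalInfinityType (m + 1) F (Weight.dual wt)) → (∀ᶠ w in cofinite, ∃ α, P.1.HasSatakeParamAt w α ∧ (ρ.restrictField F).IsUnramifiedAt w ∧ (ρ.restrictField F).HasFrobCharpolyAt w (arithFrobPolyOfSatake ι w.residueCard (m + 1) α)) → ∃ (hQ : isCompact_glFiniteIntegralLevel (m + 1) ℚ) (π : CuspidalAutomorphicRepData (m + 1) ℚ hQ), π.1.HasInfinityType (cohomologicalInfinityType (m + 1) ℚ (Weight.dual wt)) ∧ ∀ᶠ v in cofinite, ∃ α, π.1.HasSatakeParamAt v α ∧ ρ.IsUnramifiedAt v ∧ ρ.HasFrobCharpolyAt v (arithFrobPolyOfSatake ι v.residueCard (m + 1) α)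

-- earlier CriticalValuesBettiRational (stmt-Langlands-13624, replaced 2026-08-15T20:03:59Z -> stmt-Langlands-13791): retired by None — open Literature.NumberTheory.Automorphic Literature.NumberTheory.GaloisRepresentations Literature.NumberTheory.DiophantineGeometry Literature.Barriers.Langlands IsDedekindDomain NumberField in ∀ (m : ℕ), 1 ≤ m → ∀ (ℓ : ℕ) [Fact ℓ.Prime] (ι : PadicAlgCl ℓ ≃+* ℂ) (ρ : 
/-- item stmt-Langlands-13893 · crux · rank 2 · open · by planner
why it might fail: ≡ target mod AlgebraicRelationsDecide + new-vector/Satake bookkeeping (TargetImpliesCrux.lean, Evidence.lean L1/L2): false iff (B) fails for a regular pot.-automorphic ρ/ℚ. Own handle = Raghuram/Deligne algebraicity of L(s₀,ρ⊗χ×τ) with Brauer-factorised periods, in print only for CM/polarized cases.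
sources: Raghuram2009, arXiv:1312.5955, RaghuramShahidi2010, KazhdanMazurSchmidt2000, KastenSchmidt2012, arXiv:1608.07527
[crux] (card: "the cocycle identity", where (B) lives) for ρ in the target sector there are a level
N ≥ 1, a finite S and a card-(m+1) family α with ρ unramified and HasFrobCharpolyAt
(arithFrobPolyOfSatake ι q (m+1) (α v)) off S such that for EVERY criterion datum (s₀, D_even,
D_odd, δ, R) at (m, N, wt) satisfying the NECESSITY clause of AlgebraicRelationsDecide (all genuine
cuspidal π of weight wt and level K(N) kill R) there are bad-factor data γ with which the normalised
twisted Rankin–Selberg values of α kill R too (the value of a probe (S', τ, q, χ) is D(τ, parity χ)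
times the absolutely convergent Euler product over ALL places of the local multisets γ_v⊗β_v (v |
N), α_v⊗δ_v (v ∈ S'), α_v⊗β_v (else) twisted by χ at s₀). Implied by automorphy of ρ (trivially) and
implying it given AlgebraicRelationsDecide — stated openly: this is (B) in the sector, in the form
"ρ passes every level-N period-relation test that automorphic forms pass"; its own handles =
Deligne/Raghuram-type algebraicity for the twisted critical values of ρ × τ (periods factorising
along the Brauer sum of crux 4) plus coincidence of the Galois-equivariant algebraic parts with
those of level N; first open instanc -/
@[route_item "route-Langlands-MaassFreeConverse", crux]
def CriticalValuesBettiRational : Prop :=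
  open Literature.NumberTheory.Automorphic Literature.NumberTheory.GaloisRepresentations Literature.NumberTheory.DiophantineGeometry Literature.Barriers.Langlands IsDedekindDomain NumberField in ∀ (m : ℕ), 1 ≤ m → ∀ (ℓ : ℕ) [Fact ℓ.Prime] (ι : PadicAlgCl ℓ ≃+* ℂ) (ρ : FramedGaloisRep ℚ (PadicAlgCl ℓ) (m + 1)) (wt : Fin (m + 1) → ℤ) (F : Type) [Field F] [NumberField F] (hF : isCompact_glFiniteIntegralLevel (m + 1) F) (P : CuspidalAutomorphicRepData (m + 1) F hF), ρ.toGaloisRep.IsIrreducible → (∃ (wt' : Fin m → ℤ) (w' j : ℤ), (∀ i, wt' i + wt' (Fin.rev i) = w') ∧ (∀ i : Fin m, -(wt' i.rev + (j - 1)) ≤ wt i.castSucc ∧ wt i.succ ≤ -(wt' i.rev + (j - 1))) ∧ (∀ i : Fin m, -(wt' i.rev + j) ≤ wt i.castSucc ∧ wt i.succ ≤ -(wt' i.rev + j)) ∧ (∀ i : Fin m, -(wt' i.rev + (j + 1)) ≤ wt i.castSucc ∧ wt i.succ ≤ -(wt' i.rev + (j + 1)))) → P.1.HasInfinityType (cohomologicalInfinityType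 (m + 1) F (Weight.dual wt)) → (∀ᶠ w in cofinite, ∃ α, P.1.HasSatakeParamAt w α ∧ (ρ.restrictField F).IsUnramifiedAt w ∧ (ρ.restrictField F).HasFrobCharpolyAt w (arithFrobPolyOfSatake ι w.residueCard (m + 1) α)) → ∃ (N : ℕ) (S : Finset (HeightOneSpectrum (𝓞 ℚ))) (α : HeightOneSpectrum (𝓞 ℚ) → Multiset ℂ), 1 ≤ N ∧ (∀ v, Multiset.card (α v) = m + 1) ∧ (∀ v, v ∉ S → ρ.IsUnramifiedAt v ∧ ρ.HasFrobCharpolyAt v (arithFrobPolyOfSatake ι v.residueCard (m + 1) (α v))) ∧ ∀ (hc : ∀ j : ℕ, isCompact_glFiniteIntegralLevel j ℚ) (s₀ : ℂ) (De Do : ((_ : Finset (HeightOneSpectrum (𝓞 ℚ))) × {τ : CuspidalAutomorphicRepData m ℚ (hc m) // τ.1.IsRegularAlgebraic}) → ℂ) (δ : ((_ : Finset (HeightOneSpectrum (𝓞 ℚ))) × {τ : CuspidalAutomorphicRepData m ℚ (hc m) // τ.1.IsRegularAlgebraic}) → HeightOneSpectrum (𝓞 ℚ) → Multiset ℂ)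 (R : Set (((_ : ((_ : Finset (HeightOneSpectrum (𝓞 ℚ))) × {τ : CuspidalAutomorphicRepData m ℚ (hc m) // τ.1.IsRegularAlgebraic})) × (q : ℕ) × DirichletCharacter ℂ q) →₀ ℂ)), (∀ π : CuspidalAutomorphicRepData (m + 1) ℚ (hc (m + 1)), (π.1.HasInfinityType (cohomologicalInfinityType (m + 1) ℚ (Weight.dual wt)) ∧ ∃ φ ∈ π.1.W, φ ∉ π.1.W' ∧ ∀ u ∈ principalCongruenceLevel (m + 1) ℚ (Ideal.span {(N : 𝓞 ℚ)}), rightTranslation (AdelicGroupData.gl (m + 1) ℚ) u φ = φ) → ∀ απ : HeightOneSpectrum (𝓞 ℚ) → Multiset ℂ, (∀ v, ¬ v.asIdeal ∣ Ideal.span {(N : 𝓞 ℚ)} → π.1.HasSatakeParamAt v (απ v)) → ∃ γ : HeightOneSpectrum (𝓞 ℚ) → Multiset ℂ, ∀ r ∈ R, ∃ z : _ → ℂ, (∀ p ∈ r.support, ∃ (β L : HeightOneSpectrum (𝓞 ℚ) → Multiset ℂ) (E : ℂ), (∀ v, v ∉ p.1.1 → p.1.2.1.1.HasSatakeParamAt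 v (β v)) ∧ (∀ v, L v = ((if v.asIdeal ∣ Ideal.span {(N : 𝓞 ℚ)} then γ v else απ v).bind fun a => (if ¬ v.asIdeal ∣ Ideal.span {(N : 𝓞 ℚ)} ∧ v ∈ p.1.1 then δ p.1 v else β v).map fun b => a * b)) ∧ (∀ v, ∀ y ∈ L v, ‖y‖ < (v.residueCard : ℝ) ^ s₀.re) ∧ (Summable fun v : HeightOneSpectrum (𝓞 ℚ) => ((L v).map fun y => ‖y‖ * (v.residueCard : ℝ) ^ (-s₀.re)).sum) ∧ Tendsto (fun X : ℕ => ∏ᶠ v ∈ {v : HeightOneSpectrum (𝓞 ℚ) | v.residueCard ≤ X}, ((L v).map fun y => (1 - y * p.2.2 (v.residueCard : ZMod p.2.1) * (v.residueCard : ℂ) ^ (-s₀))⁻¹).prod) atTop (𝓝 E) ∧ E ≠ 0 ∧ z p = (if p.2.2.Even then De p.1 else Do p.1) * E) ∧ ∑ p ∈ r.support, r p * z p = 0) → ∃ γ : HeightOneSpectrum (𝓞 ℚ) → Multiset ℂ, ∀ r ∈ R, ∃ z : _ → ℂ, (∀ p ∈ r.support, ∃ (β L : HeightOneSpectrum (𝓞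 ℚ) → Multiset ℂ) (E : ℂ), (∀ v, v ∉ p.1.1 → p.1.2.1.1.HasSatakeParamAt v (β v)) ∧ (∀ v, L v = ((if v.asIdeal ∣ Ideal.span {(N : 𝓞 ℚ)} then γ v else α v).bind fun a => (if ¬ v.asIdeal ∣ Ideal.span {(N : 𝓞 ℚ)} ∧ v ∈ p.1.1 then δ p.1 v else β v).map fun b => a * b)) ∧ (∀ v, ∀ y ∈ L v, ‖y‖ < (v.residueCard : ℝ) ^ s₀.re) ∧ (Summable fun v : HeightOneSpectrum (𝓞 ℚ) => ((L v).map fun y => ‖y‖ * (v.residueCard : ℝ) ^ (-s₀.re)).sum) ∧ Tendsto (fun X : ℕ => ∏ᶠ v ∈ {v : HeightOneSpectrum (𝓞 ℚ) | v.residueCard ≤ X}, ((L v).map fun y => (1 - y * p.2.2 (v.residueCard : ZMod p.2.1) * (v.residueCard : ℂ) ^ (-s₀))⁻¹).prod) atTop (𝓝 E) ∧ E ≠ 0 ∧ z p = (if p.2.2.Even then De p.1 else Do p.1) * E) ∧ ∑ p ∈ r.support, r p * z p = 0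

-- earlier AlgebraicRelationsDecide (stmt-Langlands-13625, replaced 2026-08-15T20:03:59Z -> stmt-Langlands-13792): retired by None — open Literature.NumberTheory.Automorphic Literature.NumberTheory.GaloisRepresentations Literature.NumberTheory.DiophantineGeometry Literature.Barriers.Langlands IsDedekindDomain NumberField in ∀ (m : ℕ), 1 ≤ m → ∀ (N : ℕ), 1 ≤ N → ∀ (wt : Fin (m + 1) → ℤ), (∃ (wt' : Fin
/-- item stmt-Langlands-13898 · crux · rank 3 · open · by planner
why it might fail: NECESSITY near print (Raghuram 2016 Thm 1.1 per-parity periods; LRS + tempered τ for summability). CONVERSE unprinted: fails in substance if for some admissible (m,N,wt) a non-automorphic Euler family kills the ℚ̄-annihilator of the finitely many genuine value vectors; dep 13628 lacks summability.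
sources: arXiv:1312.5955, Raghuram2009, RaghuramShahidi2010, KastenSchmidt2012, Schmidt2017, Sun2016
[crux] (card S1+S2 in decidable form: the Maass-free converse theorem) for m ≥ 1, N ≥ 1, admissible
wt and the compactness facts hc there is a VALID datum: s₀ ∈ ℂ; D_even, D_odd : (S', τ) → ℂ; δ :
(S', τ) → places → multisets; R a set of finitely supported ℂ-relations on probes ((S', τ cuspidal
regular algebraic on GL_m), q, χ mod q) with ALGEBRAIC coefficients, such that NECESSITY (every
cuspidal π of GL_(m+1)/ℚ of infinity type cohomologicalInfinityType (dual wt) with a K(N)-fixed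
vector and Satake family α off N kills R for some γ) and CONVERSE (any card-(m+1) α with some γ
killing R is a.e. the Satake family of such a π) hold; a probe value is D(τ, parity χ) × the
absolutely convergent (|y| < q^(Re s₀), summable, non-zero) Euler product over all places of the
local multisets (γ⊗β at v | N, α⊗δ at v ∈ S', α⊗β elsewhere) twisted by χ at s₀; Maass τ never enter
(τ regular algebraic in the probe type). Intended witness: s₀ = interior right-half critical point,
D = c_∞/p(τ), δ = L-parameters of ramified τ_v, R = all algebraic relations of genuine value
vectors; proof route: Raghuram/Shimura/Kasten–Schmidt algebraicity ⇒ span of genuine vectors is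
ℚ̄-rational per parity; CONVERSE by -/
@[route_item "route-Langlands-MaassFreeConverse", crux]
def AlgebraicRelationsDecide : Prop :=
  open Literature.NumberTheory.Automorphic Literature.NumberTheory.GaloisRepresentations Literature.NumberTheory.DiophantineGeometry Literature.Barriers.Langlands IsDedekindDomain NumberField in ∀ (m : ℕ), 1 ≤ m → ∀ (N : ℕ), 1 ≤ N → ∀ (wt : Fin (m + 1) → ℤ), (∃ (wt' : Fin m → ℤ) (w' j : ℤ), (∀ i, wt' i + wt' (Fin.rev i) = w') ∧ (∀ i : Fin m, -(wt' i.rev + (j - 1)) ≤ wt i.castSucc ∧ wt i.succ ≤ -(wt' i.rev + (j - 1))) ∧ (∀ i : Fin m, -(wt' i.rev + j) ≤ wt i.castSucc ∧ wt i.succ ≤ -(wt' i.rev + j)) ∧ (∀ i : Fin m, -(wt' i.rev + (j + 1)) ≤ wt i.castSucc ∧ wt i.succ ≤ -(wt' i.rev + (j + 1)))) → ∀ (hc : ∀ j : ℕ, isCompact_glFiniteIntegralLevel j ℚ), ∃ (s₀ : ℂ) (De Do : ((_ : Finset (HeightOneSpectrum (𝓞 ℚ))) × {τ : CuspidalAutomorphicRepData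 m ℚ (hc m) // τ.1.IsRegularAlgebraic}) → ℂ) (δ : ((_ : Finset (HeightOneSpectrum (𝓞 ℚ))) × {τ : CuspidalAutomorphicRepData m ℚ (hc m) // τ.1.IsRegularAlgebraic}) → HeightOneSpectrum (𝓞 ℚ) → Multiset ℂ) (R : Set (((_ : ((_ : Finset (HeightOneSpectrum (𝓞 ℚ))) × {τ : CuspidalAutomorphicRepData m ℚ (hc m) // τ.1.IsRegularAlgebraic})) × (q : ℕ) × DirichletCharacter ℂ q) →₀ ℂ)), (∀ r ∈ R, ∀ p, IsAlgebraic ℚ (r p)) ∧ (∀ π : CuspidalAutomorphicRepData (m + 1) ℚ (hc (m + 1)), (π.1.HasInfinityType (cohomologicalInfinityType (m + 1) ℚ (Weight.dual wt)) ∧ ∃ φ ∈ π.1.W, φ ∉ π.1.W' ∧ ∀ u ∈ principalCongruenceLevel (m + 1) ℚ (Ideal.span {(N : 𝓞 ℚ)}), rightTranslation (AdelicGroupData.gl (m + 1) ℚ) u φ = φ) → ∀ απ : HeightOneSpectrum (𝓞 ℚ) → Multiset ℂ, (∀ v, ¬ v.asIdeal ∣ Ideal.span {(N : 𝓞 ℚ)}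 → π.1.HasSatakeParamAt v (απ v)) → ∃ γ : HeightOneSpectrum (𝓞 ℚ) → Multiset ℂ, ∀ r ∈ R, ∃ z : _ → ℂ, (∀ p ∈ r.support, ∃ (β L : HeightOneSpectrum (𝓞 ℚ) → Multiset ℂ) (E : ℂ), (∀ v, v ∉ p.1.1 → p.1.2.1.1.HasSatakeParamAt v (β v)) ∧ (∀ v, L v = ((if v.asIdeal ∣ Ideal.span {(N : 𝓞 ℚ)} then γ v else απ v).bind fun a => (if ¬ v.asIdeal ∣ Ideal.span {(N : 𝓞 ℚ)} ∧ v ∈ p.1.1 then δ p.1 v else β v).map fun b => a * b)) ∧ (∀ v, ∀ y ∈ L v, ‖y‖ < (v.residueCard : ℝ) ^ s₀.re) ∧ (Summable fun v : HeightOneSpectrum (𝓞 ℚ) => ((L v).map fun y => ‖y‖ * (v.residueCard : ℝ) ^ (-s₀.re)).sum) ∧ Tendsto (fun X : ℕ => ∏ᶠ v ∈ {v : HeightOneSpectrum (𝓞 ℚ) | v.residueCard ≤ X}, ((L v).map fun y => (1 - y * p.2.2 (v.residueCard : ZMod p.2.1) * (v.residueCard : ℂ) ^ (-s₀))⁻¹).prod)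 atTop (𝓝 E) ∧ E ≠ 0 ∧ z p = (if p.2.2.Even then De p.1 else Do p.1) * E) ∧ ∑ p ∈ r.support, r p * z p = 0) ∧ (∀ α γ : HeightOneSpectrum (𝓞 ℚ) → Multiset ℂ, (∀ v, Multiset.card (α v) = m + 1) → (∀ r ∈ R, ∃ z : _ → ℂ, (∀ p ∈ r.support, ∃ (β L : HeightOneSpectrum (𝓞 ℚ) → Multiset ℂ) (E : ℂ), (∀ v, v ∉ p.1.1 → p.1.2.1.1.HasSatakeParamAt v (β v)) ∧ (∀ v, L v = ((if v.asIdeal ∣ Ideal.span {(N : 𝓞 ℚ)} then γ v else α v).bind fun a => (if ¬ v.asIdeal ∣ Ideal.span {(N : 𝓞 ℚ)} ∧ v ∈ p.1.1 then δ p.1 v else β v).map fun b => a * b)) ∧ (∀ v, ∀ y ∈ L v, ‖y‖ < (v.residueCard : ℝ) ^ s₀.re) ∧ (Summable fun v : HeightOneSpectrum (𝓞 ℚ) => ((L v).map fun y => ‖y‖ * (v.residueCard : ℝ) ^ (-s₀.re)).sum) ∧ Tendsto (fun X : ℕ => ∏ᶠ v ∈ {v : HeightOneSpectrum (𝓞 ℚ)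 | v.residueCard ≤ X}, ((L v).map fun y => (1 - y * p.2.2 (v.residueCard : ZMod p.2.1) * (v.residueCard : ℂ) ^ (-s₀))⁻¹).prod) atTop (𝓝 E) ∧ E ≠ 0 ∧ z p = (if p.2.2.Even then De p.1 else Do p.1) * E) ∧ ∑ p ∈ r.support, r p * z p = 0) → ∃ π : CuspidalAutomorphicRepData (m + 1) ℚ (hc (m + 1)), (π.1.HasInfinityType (cohomologicalInfinityType (m + 1) ℚ (Weight.dual wt)) ∧ ∃ φ ∈ π.1.W, φ ∉ π.1.W' ∧ ∀ u ∈ principalCongruenceLevel (m + 1) ℚ (Ideal.span {(N : 𝓞 ℚ)}), rightTranslation (AdelicGroupData.gl (m + 1) ℚ) u φ = φ) ∧ ∀ᶠ v in cofinite, π.1.HasSatakeParamAt v (α v))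

-- earlier SolubleJointPotentialAutomorphy (stmt-Langlands-13626, replaced 2026-08-15T20:03:59Z -> stmt-Langlands-13793): retired by None — open Literature.NumberTheory.Automorphic Literature.NumberTheory.GaloisRepresentations Literature.NumberTheory.DiophantineGeometry Literature.Barriers.Langlands IsDedekindDomain NumberField in ∀ (m : ℕ), 1 ≤ m → ∀ (ℓ : ℕ) [Fact ℓ.Prime] (ι : PadicAlgCl ℓ ≃+* ℂ) (
/-- item stmt-Langlands-13899 · support · rank 4 · open · by planner
why it might fail: Truth pinned by the target (⇒ this via F′:=ℚ, CruxAttack.lean; only transport along E≃ℚ missing); idle in closes. As a tool beyond print: one ℓ-adic ρ automorphic over arbitrary F, no oddness/polarization/compatible system (BLGGT 4.5.1, Qian, ACC+); BC of non-self-dual τ to insoluble E open.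
sources: BarnetlambEtAl2014, arXiv:1010.2561, Taylor2006, Qian2022, ACCGHLNSTT2023, PatrikisTaylor2014
[crux] (card S3, in Taylor's "soluble shape") for ρ in the target sector and every cuspidal regular
algebraic τ on GL_m/ℚ there is a finite Galois F'/ℚ, totally real or CM, such that over EVERY E ⊆ F'
with Gal(F'/E) soluble, ρ|_E is Satake–Frobenius compatible a.e. with a cuspidal regular algebraic
rep of GL_(m+1)(𝔸_E) and τ has an automorphic weak base change to E. By Brauer over Gal(F'/ℚ) and
Jacquet–PS–Shalika this makes Λ(s, ρ ⊗ χ × τ) meromorphic with functional equation and every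
off-centre critical value an unconditional number (layer 2 of CriticalValuesBettiRational: explicit
Manin-type relations mixing both halves; Brauer factorisation of periods). [difficulty:
open-problem] [rev 1: the admissibility clause writes RelativeModularSymbol.Interlaces wt
(Weight.dual (wt' + k)), k = j−1, j, j+1, out verbatim as ∀ i, −(wt' i.rev + k) ≤ wt i.castSucc ∧ wt
i.succ ≤ −(wt' i.rev + k) — definitionally the rev-0 statement (Iff.rfl, Equiv.lean in the repair
folder); no import of RelativeModularSymbolPresentation.] -/
@[route_item "route-Langlands-MaassFreeConverse"]
def SolubleJointPotentialAutomorphy : Prop :=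
  open Literature.NumberTheory.Automorphic Literature.NumberTheory.GaloisRepresentations Literature.NumberTheory.DiophantineGeometry Literature.Barriers.Langlands IsDedekindDomain NumberField in ∀ (m : ℕ), 1 ≤ m → ∀ (ℓ : ℕ) [Fact ℓ.Prime] (ι : PadicAlgCl ℓ ≃+* ℂ) (ρ : FramedGaloisRep ℚ (PadicAlgCl ℓ) (m + 1)) (wt : Fin (m + 1) → ℤ) (F : Type) [Field F] [NumberField F] (hF : isCompact_glFiniteIntegralLevel (m + 1) F) (P : CuspidalAutomorphicRepData (m + 1) F hF), ρ.toGaloisRep.IsIrreducible → (∃ (wt' : Fin m → ℤ) (w' j : ℤ), (∀ i, wt' i + wt' (Fin.rev i) = w') ∧ (∀ i : Fin m, -(wt' i.rev + (j - 1)) ≤ wt i.castSucc ∧ wt i.succ ≤ -(wt' i.rev + (j - 1))) ∧ (∀ i : Fin m, -(wt' i.rev + j) ≤ wt i.castSucc ∧ wt i.succ ≤ -(wt' i.rev + j)) ∧ (∀ i : Fin m, -(wt' i.rev + (j + 1)) ≤ wt i.castSucc ∧ wt i.succ ≤ -(wt' i.rev + (j + 1)))) → P.1.HasInfinityType (cohomologicalInfinityType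 (m + 1) F (Weight.dual wt)) → (∀ᶠ w in cofinite, ∃ α, P.1.HasSatakeParamAt w α ∧ (ρ.restrictField F).IsUnramifiedAt w ∧ (ρ.restrictField F).HasFrobCharpolyAt w (arithFrobPolyOfSatake ι w.residueCard (m + 1) α)) → ∀ (hc : ∀ j : ℕ, isCompact_glFiniteIntegralLevel j ℚ) (τ : CuspidalAutomorphicRepData m ℚ (hc m)), τ.1.IsRegularAlgebraic → ∃ (F' : Type) (_ : Field F') (_ : NumberField F'), IsGalois ℚ F' ∧ (IsTotallyReal F' ∨ IsCMField F') ∧ ∀ (E : Type) [Field E] [NumberField E] [Algebra E F'], IsSolvable (F' ≃ₐ[E] F') → (∃ (hE : isCompact_glFiniteIntegralLevel (m + 1) E) (Q : CuspidalAutomorphicRepData (m + 1) E hE), Q.1.IsRegularAlgebraic ∧ ∀ᶠ u in cofinite, ∃ α, Q.1.HasSatakeParamAt u α ∧ (ρ.restrictField E).IsUnramifiedAt u ∧ (ρ.restrictField E).HasFrobCharpolyAt u (arithFrobPolyOfSatake ι u.residueCard (m + 1) α)) ∧ (∃ (hE' : isCompact_glFiniteIntegralLevel m E) (T : AutomorphicRepData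 (AutomorphyDatum.gl m E hE')), ∀ᶠ u in cofinite, ∃ γ, T.HasSatakeParamAt u γ ∧ ∃ β, τ.1.HasSatakeParamAt (u.under (𝓞 ℚ)) β ∧ γ = β.map fun b => b ^ u.asIdeal.inertiaDeg (𝓞 ℚ))

-- item stmt-Langlands-13658 · support · rank 5 · open · by planner — informal only, no Lean statement yet:
--   [crux] EXPLICIT MODE (card S1+S2; informal until the definition request KMSRelativeSymbol lands):
--   for n = m+1 in {2,3,4}, N >= 1 and admissible wt, the relation module rel(P_KMS) of the
--   Kazhdan-Mazur-Schmidt presentation (RelativeModularSymbolPresentation m N wt whose symbol map IS the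
--   pairing of the canonical fast-decreasing lift of a class of CuspidalCohomologyGL (m+1) N wt with the
--   relative cycle F_g capped with a class of GL_m), restricted to names with cuspidal-or-Eisenstein
--   eigenclasses and off-centre critical shifts, is generated by (a) linearity in the class, (b) the
--   double-coset relat

/-- item stmt-Langlands-13627 · support · rank 9 · open · by planner
sources: BuzzardGeeLMS2014, FontaineMazurGeometric1995, BarnetlambEtAl2014
[support] the rest of the summit: (B) in the regular admissible sector over ℚ (a.e. form) ⇒
Langlands (upgrade a.e. to Corresponds by LGC + strong multiplicity one; geometric ⇒ potentially
automorphic; weights with < 3 critical shifts incl. weight-2 type and Artin type; other n, F;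
direction (A)). Not this route's business; filed so that closes ends in the summit constant (same
convention as the other sector routes of this summit). [difficulty: open-problem] -/
@[route_item "route-Langlands-MaassFreeConverse", crux]
def RegularSectorJunction : Prop :=
  RegularInsolubleDescent → _root_.Langlands

/-- item stmt-Langlands-13628 · support · rank 9 · open · by planner
sources: LuoRamakrishnan1997, doi:10.1515/forum.2006.001, JacquetShalikaAJM1981
[support] (the linear-independence lemma CONVERSE rests on; provable now) finitely many families of
local multisets M_i : places → nonzero complex numbers of bounded size with ‖x‖ ≤ C q^θ, ‖x‖ < q^(Re
s₀), Re s₀ > 1 + θ, PAIRWISE DIFFERENT AT INFINITELY MANY PLACES: the functions (q, χ) ↦ lim_X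
∏_(q_v ≤ X) ∏_(x ∈ M_i v) (1 − x χ(v) q_v^(−s₀))^(−1) on Dirichlet characters of a fixed parity and
conductor-modulus prime to a finite B are linearly independent over ℂ. (Infinite distinctness is
necessary: 1/((1−yX)(1−zX)) = 2/((1−xX)(1−zX)) − 1/((1−xX)(1−yX)) for x, y, z in arithmetic
progression — distinct Euler products differing at one place can be dependent.) Proof: orthogonality
over χ mod large primes extracts Dirichlet coefficients; then induction on the number of families
using a separating place. [difficulty: provable-now] -/
@[route_item "route-Langlands-MaassFreeConverse"]
def TwistedEulerIndependence : Prop :=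
  open Literature.NumberTheory.Automorphic Literature.NumberTheory.GaloisRepresentations Literature.NumberTheory.DiophantineGeometry Literature.Barriers.Langlands IsDedekindDomain NumberField in ∀ (B : Finset (HeightOneSpectrum (𝓞 ℚ))) (s₀ : ℂ) (θ C : ℝ) (k r : ℕ) (b : Bool) (M : Fin r → HeightOneSpectrum (𝓞 ℚ) → Multiset ℂ), (∀ i v, Multiset.card (M i v) ≤ k ∧ ∀ x ∈ M i v, x ≠ 0 ∧ ‖x‖ ≤ C * (v.residueCard : ℝ) ^ θ ∧ ‖x‖ < (v.residueCard : ℝ) ^ s₀.re) → 1 + θ < s₀.re → (∀ i j, i ≠ j → {v : HeightOneSpectrum (𝓞 ℚ) | M i v ≠ M j v}.Infinite) → ∀ e : Fin r → {x : (q : ℕ) × DirichletCharacter ℂ q // 0 < x.1 ∧ (∀ v ∈ B, ¬ v.residueCard ∣ x.1) ∧ x.2 (-1) = (if b then 1 else -1)} → ℂ, (∀ i x, Tendsto (fun X : ℕ => ∏ᶠ v ∈ {v : HeightOneSpectrum (𝓞 ℚ) | v.residueCard ≤ X}, ((M i v).map fun y => (1 - y * x.1.2 (v.residueCard : ZMod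 x.1.1) * (v.residueCard : ℂ) ^ (-s₀))⁻¹).prod) atTop (𝓝 (e i x))) → LinearIndependent ℂ e

-- item stmt-Langlands-13659 · support · rank 9 · open · by planner — informal only, no Lean statement yet:
--   [support] n = 2 CALIBRATION (card S5; informal until twistedRankinSelbergEulerValue lands; then
--   typable over ManinSymbolsWeightK / PolySymbol / EichlerShimuraPeriodsGamma1): for k >= 4, N >= 1 and
--   rho : G_Q -> GL_2(Qbar_l) irreducible, potentially automorphic of weight k (weightInfinityTypeGL2
--   over a totally real F, Taylor2006 shape): rho is modular of level Gamma_1(N) iff the function on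
--   Manin symbols [g Gamma_1(N), q] -> sum_j binomial weights x (continued additive-twist critical
--   values Lambda(rho, g^{-1}0, j+1) - Lambda(rho, g^{-1}oo, j+1)), restricted to the parity class of j
--   avoiding the

-- item stmt-Langlands-13660 · support · rank 9 · open · by planner — informal only, no Lean statement yet:
--   [support] (card S4; informal until twistedRankinSelbergEulerValue lands) under the conclusion of
--   SolubleJointPotentialAutomorphy for (rho, tau): Lambda(s, rho (x) chi x tau) := the Brauer virtual
--   product over Gal(F'/Q) of automorphic Rankin-Selberg L-functions over the fields E_j with F'/E_j
--   soluble is meromorphic on C with functional equation s <-> 1 - s (contragredients), and at every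
--   OFF-CENTRE critical point it is finite and non-zero (right of the boundary: absolute convergence; on
--   the boundary: Jacquet-Shalika / Shahidi non-vanishing and holomorphy of L(s, Pi x T) for T not a
--   twist of Pi-

/-- item stmt-Langlands-14446 · support · rank 9 · closed · proved by Summit.Langlands.Langlands.Theorems.MaassFreeConverseCriterionDescent.criterionDescent_proof (prover) · by planner
sources: Raghuram2009, BuzzardGeeLMS2014
[support] GLUE (rev-5 badge repair): the two cruxes imply the target — CriticalValuesBettiRational →
AlgebraicRelationsDecide → RegularInsolubleDescent — so the target is reachable from the cruxes by
an ITEM (route.target-unreachable) and `closes` can read hJ (hG hB hD). Elementary logic, provable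
now; proof = the rev-0…4 inline body of `closes` (rc 0 sorry-free in the planner's Sketch.lean,
attached as candidate proof): K_B gives (N, S, α) and the ∀-datum clause; K_D with hc :=
isCompact_glFiniteIntegralLevel_holds gives a valid datum (algebraic ∧ NECESSITY ∧ CONVERSE); the
clause fed NECESSITY gives γ killing R; CONVERSE gives a cuspidal π of weight wt with
HasSatakeParamAt v (α v) a.e.; intersect with the cofinite complement of S. [deps:
CriticalValuesBettiRational, AlgebraicRelationsDecide] [difficulty: provable-now] -/
@[route_item "route-Langlands-MaassFreeConverse", crux]
def CriterionDescent : Prop :=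
  CriticalValuesBettiRational → AlgebraicRelationsDecide → RegularInsolubleDescent

-- `CriterionDescent` holds: proved by `Summit.Langlands.Langlands.Theorems.MaassFreeConverseCriterionDescent.criterionDescent_proof` (its module imports this route file, so no `_holds` link can be stated here).

/-- item stmt-Langlands-13631 · assembly · rank 1 · open · by planner
sources: BuzzardGeeLMS2014, Raghuram2009
[assembly] CriticalValuesBettiRational → AlgebraicRelationsDecide → SolubleJointPotentialAutomorphy
→ RegularSectorJunction → Langlands. -/
@[route_item "route-Langlands-MaassFreeConverse"]
def Assembly : Prop :=
  CriticalValuesBettiRational → AlgebraicRelationsDecide → SolubleJointPotentialAutomorphy → RegularSectorJunction → _root_.Langlands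

/-! D-0027 §2.1 — DECIDING THEOREM (planner-authored via `route open/edit --closes-file`; by planner-rbadge-Langlands-MaassFreeConverse-597186cf-0 2026-08-16T03:31:09Z):
its hypotheses are this route's items and its conclusion the sub-problem Statement (glue_lint), and it elaborates with this file. -/

@[closes "route-Langlands-MaassFreeConverse"] theorem closes (hB : CriticalValuesBettiRational) (hD : AlgebraicRelationsDecide)
    (hG : CriterionDescent) (hJ : RegularSectorJunction) : _root_.Langlands :=
  hJ (hG hB hD)

end Summit.Langlands.Langlands.Theses.MaassFreeConverse
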